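import Summits.AnomalousDissipation.AnomalousDissipation.Theorems.SolenoidalFractalHomogenisationLagrangianStepFlatBilinearWindowCos
import HarnessLib

/-!
# K1L_D (stmt-AnomalousDissipation-27980), line «onelevel-design», brick Z4♭ — THE FLAT SLOW×SLOW BILINEAR BOUND ON ONE GRID WINDOW, in the
# currency of (V)'s error function (helper; `--supports … --as helper`; lead-k1l-onelevel-p1 g4)

For the FLAT pair (`Um1` = cell propagator along `E.level (m+1)` with `kbar(m+1)•S`, `Um` = carrier-free effective propagator with
`kbar m•renormStep (Φν) (gain/ν²) S`) of an `LPermissible` carrier replaying `W.stretch M`, a regime level (`cellVisc(m+1) < ν₀`), a trim level `Lc`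
with `Lc < N(m+1)` and `(Lc/2)·⌈K/ν⌉ ≤ N(m+1)`, a grid window `[j·r, s']` (`s' ≤ 1`), and ALL `x, y ∈ V2` supported on `S = freqBall(Lc/2)∖{0}`:

  `|⟪Um1 (jr) s' x − Um (jr) s' x, y⟫| ≤ Σ_{ℓ∈S} 2√2·err_ℓ(a(m+1)(s' − jr))·‖𝓕x(ℓ)‖·‖𝓕y(ℓ)‖`   (`abs_inner_window_sub_le_sum`).

Composition: cosine bound at the window end (`…FlatBilinearWindowCos`) → pair data (`…PairData`, sine witness `e_{i₀}/N`, `…PropagatorTranslate`) →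
slow-supported data (`…FlatBilinearAssembly`; class preservation `…PropagatorClass`; Leray `apply_eq_apply_starProjection`); the slow modes are
alone in their class pairs and not self-conjugate because `Lc < N(m+1)` (`alone_of_lt`, `not_selfConj_of_lt`).
The template bookkeeping and the text plumbing ride in `…FlatBilinearSlow`.  NOT a proof of any registered stub, of the crux, or of AD; rung F-D1.A0.
-/

set_option linter.dupNamespace false  -- the summit-side namespace `Summit.AnomalousDissipation.AnomalousDissipation.…` repeats a component by design (D-0017)

noncomputable section

namespace Summit.AnomalousDissipation.AnomalousDissipation.Theorems.SolenoidalFractalHomogenisation.LagrangianStep.FlatWindow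

open Literature.Analysis Literature.Analysis.FluidPDE Literature.Analysis.FluidPDE.Torus Literature.Analysis.FunctionSpaces
open MeasureTheory Set Filter UnitAddTorus Function Complex
open scoped ENNReal NNReal InnerProductSpace
open OneLevelSplit PropagatorSymm CellTime
open Literature.Analysis.FluidPDE.LatticeShear (LagrangianLatticeCarrier LatticeWord)
open Summit.AnomalousDissipation.AnomalousDissipation.Theorems.SolenoidalFractalHomogenisation.LagrangianRenormalisationStep
  (cellVisc_pos' memLp_top_stLift_of_continuous continuous_uncurry_level)
open Summit.AnomalousDissipation.AnomalousDissipation.Theorems.SolenoidalFractalHomogenisation.PermissibleCarrier (isWeaklyDivFree_level)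

variable {k : ℕ}

/-! ## Slow modes below `Lc/2 < N/2`: coordinates, classes -/

/-- A coordinate of a frequency in `freqBall L` is at most `L` in absolute value. -/
theorem abs_coord_le_of_mem_freqBall {L : ℕ} {ℓ : Fin 3 → ℤ} (h : ℓ ∈ Torus.freqBall L) (i : Fin 3) : |(ℓ i : ℝ)| ≤ L := by
  rw [Torus.mem_freqBall] at h
  have h1 : (ℓ i : ℝ) ^ 2 ≤ Torus.freqNormSq ℓ := by
    unfold Torus.freqNormSq
    exact Finset.single_le_sum (f := fun i => ((ℓ i : ℝ)) ^ 2) (fun i _ => sq_nonneg _) (Finset.mem_univ i)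
  exact abs_le_of_sq_le_sq' (by linarith) (Nat.cast_nonneg L) |>.2 |> fun h' => abs_le.2 ⟨(abs_le_of_sq_le_sq' (by linarith) (Nat.cast_nonneg L)).1, h'⟩

/-- **Alone in the class pair**: two frequencies in `freqBall L` with `2L < N` that are congruent `mod N` coordinatewise (directly or up to sign) are
equal (up to sign). -/
theorem alone_of_lt {L N : ℕ} (hLN : 2 * L < N) {ℓ k' : Fin 3 → ℤ} (hℓ : ℓ ∈ Torus.freqBall L) (hk : k' ∈ Torus.freqBall L)
    (hpair : (∀ i, (N:ℤ) ∣ k' i - ℓ i) ∨ (∀ i, (N:ℤ) ∣ k' i + ℓ i)) : k' = ℓ ∨ k' = -ℓ := by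
  have hLN' : (2:ℝ) * L < N := by exact_mod_cast hLN
  have hsmall : ∀ (u : ℤ), |(u : ℝ)| ≤ 2 * L → (N:ℤ) ∣ u → u = 0 := by
    intro u hu hdvd
    have h1 : |u| < (N:ℤ) := by
      have : ((|u| : ℤ) : ℝ) < (N : ℝ) := by rw [Int.cast_abs]; exact lt_of_le_of_lt hu hLN'
      exact_mod_cast this
    exact Int.eq_zero_of_abs_lt_dvd hdvd h1
  rcases hpair with h | h
  · left; funext i
    have := hsmall (k' i - ℓ i) (by
      push_cast
      exact (abs_sub _ _).trans (by linarith [abs_coord_le_of_mem_freqBall hk i, abs_coord_le_of_mem_freqBall hℓ i])) (h i)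
    linarith
  · right; funext i
    have := hsmall (k' i + ℓ i) (by
      push_cast
      exact (abs_add_le _ _).trans (by linarith [abs_coord_le_of_mem_freqBall hk i, abs_coord_le_of_mem_freqBall hℓ i])) (h i)
    rw [Pi.neg_apply]; linarith

/-- **Not self-conjugate**: a nonzero frequency in `freqBall L`, `2L < N`, has a coordinate `i₀` with `ℓ i₀ ≠ 0` and `2|ℓ i₀| < N`; in particular
`¬ ∀ i, N ∣ ℓ i + ℓ i`. -/
theorem exists_coord_of_ne_zero {L N : ℕ} (hLN : 2 * L < N) {ℓ : Fin 3 → ℤ} (hℓ : ℓ ∈ Torus.freqBall L) (hℓ0 : ℓ ≠ 0) :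
    ∃ i₀, ℓ i₀ ≠ 0 ∧ 2 * |ℓ i₀| < N := by
  have : ∃ i₀, ℓ i₀ ≠ 0 := by
    by_contra h
    push Not at h
    exact hℓ0 (funext h)
  obtain ⟨i₀, hi₀⟩ := this
  refine ⟨i₀, hi₀, ?_⟩
  have h1 := abs_coord_le_of_mem_freqBall hℓ i₀
  have hLN' : (2:ℝ) * L < N := by exact_mod_cast hLN
  have : ((2 * |ℓ i₀| : ℤ) : ℝ) < N := by
    rw [Int.cast_mul, Int.cast_abs]; push_cast; linarith
  exact_mod_cast this

/-- **Not self-conjugate**: a nonzero frequency in `freqBall L`, `2L < N`, is not congruent to its negative mod `N`. -/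
theorem not_selfConj_of_lt {L N : ℕ} (hLN : 2 * L < N) {ℓ : Fin 3 → ℤ} (hℓ : ℓ ∈ Torus.freqBall L) (hℓ0 : ℓ ≠ 0) :
    ¬ ∀ i, (N:ℤ) ∣ ℓ i + ℓ i := by
  obtain ⟨i₀, hi₀, hsmall⟩ := exists_coord_of_ne_zero hLN hℓ hℓ0
  intro h
  have h1 : |ℓ i₀ + ℓ i₀| < N := by rw [← two_mul, abs_mul, abs_two]; exact_mod_cast hsmall
  have := Int.eq_zero_of_abs_lt_dvd (h i₀) h1
  exact hi₀ (by omega)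

/-! ## The window bound -/

/-- **THE FLAT SLOW×SLOW WINDOW BOUND** (Z4♭ in (V)'s currency).  See the module docstring. -/
theorem abs_inner_window_sub_le_sum (E : LagrangianLatticeCarrier k) (hL : E.LPermissible) {W : LatticeWord k} {M : ℝ} {hM : 0 < M}
    (hdes : E.design = W.stretch M hM) {c : ℝ} (hgain : E.gain = c) (m : ℕ)
    {Φ : ℝ → FluidPDE.Torus.Visc4 (Fin 3) → FluidPDE.Torus.Visc4 (Fin 3)} {lo hi Λ β σ C ν₀ K : ℝ}
    (hV : SlowVectorClauseF W M hM c Φ lo hi Λ β σ C ν₀ K) (hΛ : 1 ≤ Λ) (hlo : 0 < lo) (hhi : lo ≤ hi) (hc : 0 < c) (hC : 0 ≤ C)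
    (hν₀ : E.cellVisc (m + 1) < ν₀)
    {S : FluidPDE.Torus.Visc4 (Fin 3)} (hSo : FluidPDE.Torus.OddSmall S β) (hSn : FluidPDE.Torus.NearIso S lo hi)
    (hΦSn : FluidPDE.Torus.NearIso (Φ (E.cellVisc (m + 1)) S) lo hi)
    {Um Um1 : ℝ → ℝ → (V2 →L[ℝ] V2)}
    (hUm : FluidPDE.Torus.IsPropagator 1 (fun (_ : ℝ) (_ : UnitAddTorus (Fin 3)) => (0 : EuclideanSpace ℝ (Fin 3)))
      (E.kbar m • renormStep (Φ (E.cellVisc (m + 1))) (E.gain / E.cellVisc (m + 1) ^ 2) S) Um)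
    (hUm1 : FluidPDE.Torus.IsPropagator 1 (E.toFractalCarrierData.level (m + 1)) (E.kbar (m + 1) • S) Um1)
    (Lc : ℕ) (hLcN : 2 * (Lc / 2) < E.N (m + 1)) (hscale : ((Lc / 2 : ℕ) : ℝ) * (⌈K / E.cellVisc (m + 1)⌉₊ : ℝ) ≤ E.N (m + 1))
    (j : ℕ) {s' : ℝ} (h1 : (j : ℝ) * E.refresh (m + 1) < s') (h3 : s' ≤ 1) (x y : V2)
    (hxS : ∀ k', k' ∉ (Torus.freqBall (Lc / 2)).erase 0 → mFourierCoeff (EuclideanSpace.complexify ∘ ⇑x) k' = 0)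
    (hyS : ∀ k', k' ∉ (Torus.freqBall (Lc / 2)).erase 0 → mFourierCoeff (EuclideanSpace.complexify ∘ ⇑y) k' = 0) :
    |⟪Um1 ((j : ℝ) * E.refresh (m + 1)) s' x - Um ((j : ℝ) * E.refresh (m + 1)) s' x, y⟫_ℝ|
      ≤ ∑ ℓ ∈ (Torus.freqBall (Lc / 2)).erase 0,
          (2 * Real.sqrt 2 * (C * (C * (E.cellVisc (m + 1) ^ σ + (‖Torus.latticeVec ℓ‖ * (⌈K / E.cellVisc (m + 1)⌉₊ : ℝ) / E.N (m + 1)) ^ σ)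
              * min 1 ((8 * Real.pi ^ 2 * ‖Torus.latticeVec ℓ‖ ^ 2 * (hi * Λ) * (E.cellVisc (m + 1) + c / E.cellVisc (m + 1)) / (E.N (m + 1) : ℝ) ^ 2) * (E.a (m + 1) * (s' - (j : ℝ) * E.refresh (m + 1))))
            + (8 * Real.pi ^ 2 * ‖Torus.latticeVec ℓ‖ ^ 2 * (hi * Λ) * (E.cellVisc (m + 1) + c / E.cellVisc (m + 1)) / (E.N (m + 1) : ℝ) ^ 2)
              * (M * W.period / E.cellVisc (m + 1)))))
            * ‖mFourierCoeff (EuclideanSpace.complexify ∘ ⇑x) ℓ‖ * ‖mFourierCoeff (EuclideanSpace.complexify ∘ ⇑y) ℓ‖ := by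
  set s : ℝ := (j : ℝ) * E.refresh (m + 1) with hs_def
  set N : ℕ := E.N (m + 1) with hN_def
  have hN : 0 < N := E.N_pos (m + 1)
  have hs0 : 0 ≤ s := mul_nonneg (Nat.cast_nonneg _) (E.refresh_pos _).le
  have hs1 : s < 1 := lt_of_lt_of_le h1 h3
  have hν := cellVisc_pos' E.toFractalCarrierData (m + 1)
  -- carriers: ellipticity, boundedness, divergence-freeness, grid invariance
  have h𝔸1 : FluidPDE.Torus.NearIso (E.kbar (m + 1) • S) (E.kbar (m + 1) * lo) (E.kbar (m + 1) * hi) := hSn.smul (E.kbar_pos _).le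
  have hlo1 : 0 < E.kbar (m + 1) * lo := mul_pos (E.kbar_pos _) hlo
  have hg : 0 ≤ E.gain / E.cellVisc (m + 1) ^ 2 := div_nonneg E.gain_pos.le (sq_nonneg _)
  have h𝔸0 : FluidPDE.Torus.NearIso (E.kbar m • renormStep (Φ (E.cellVisc (m + 1))) (E.gain / E.cellVisc (m + 1) ^ 2) S)
      (E.kbar m * lo) (E.kbar m * hi) := (WindowDuality.nearIso_renormStep' hSn hΦSn hg).smul (E.kbar_pos m).le
  have hlo0 : 0 < E.kbar m * lo := mul_pos (E.kbar_pos _) hlo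
  have hb1 : MemLp (FunctionSpaces.Torus.stLift (E.toFractalCarrierData.level (m + 1))) ∞
      (volume.restrict (Ioo 0 1 ×ˢ (univ : Set (EuclideanSpace ℝ (Fin 3))))) :=
    memLp_top_stLift_of_continuous (continuous_uncurry_level E.toFractalCarrierData (m + 1)) 1
  have hbdiv1 : ∀ᵐ t ∂(volume.restrict (Ioo (0:ℝ) 1)), FunctionSpaces.Torus.IsWeaklyDivFree (E.toFractalCarrierData.level (m + 1) t) :=
    ae_of_all _ fun t => isWeaklyDivFree_level E.toFractalCarrierData (m + 1) t
  have hb0 : MemLp (FunctionSpaces.Torus.stLift (fun (_ : ℝ) (_ : UnitAddTorus (Fin 3)) => (0 : EuclideanSpace ℝ (Fin 3)))) ∞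
      (volume.restrict (Ioo 0 1 ×ˢ (univ : Set (EuclideanSpace ℝ (Fin 3))))) := memLp_top_const 0
  have hbdiv0 : ∀ᵐ t ∂(volume.restrict (Ioo (0:ℝ) 1)),
      FunctionSpaces.Torus.IsWeaklyDivFree ((fun (_ : ℝ) (_ : UnitAddTorus (Fin 3)) => (0 : EuclideanSpace ℝ (Fin 3))) t) :=
    ae_of_all _ fun t θ hθ => by simp
  have hgrid1 : ∀ (jj : Fin 3 → Fin N) (t : ℝ) (z : UnitAddTorus (Fin 3)),
      E.toFractalCarrierData.level (m + 1) t (z + (fun i => ((((jj i : ℕ) : ℝ) / N : ℝ) : UnitAddCircle)))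
        = E.toFractalCarrierData.level (m + 1) t z := by
    intro jj t z
    simp only [LatticeShear.FractalCarrierData.level]
    rw [cell_add_grid _ hN]
  have hgrid0 : ∀ (jj : Fin 3 → Fin N) (t : ℝ) (z : UnitAddTorus (Fin 3)),
      (fun (_ : ℝ) (_ : UnitAddTorus (Fin 3)) => (0 : EuclideanSpace ℝ (Fin 3))) t (z + (fun i => ((((jj i : ℕ) : ℝ) / N : ℝ) : UnitAddCircle)))
        = (fun (_ : ℝ) (_ : UnitAddTorus (Fin 3)) => (0 : EuclideanSpace ℝ (Fin 3))) t z := fun _ _ _ => rfl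
  -- the assembly
  refine abs_inner_sub_le_sum_of_modewise ((Torus.freqBall (Lc / 2)).erase 0) (Um1 s s') (Um s s') _ hN ?_ ?_ ?_ ?_ ?_ ?_ ?_ ?_ x y hxS hyS
  · -- alone
    intro ℓ hℓ k' hk' hpair
    rw [Finset.mem_erase] at hℓ hk'
    exact alone_of_lt hLcN hℓ.2 hk'.2 hpair
  · -- not self-conjugate
    intro ℓ hℓ
    rw [Finset.mem_erase] at hℓ
    exact not_selfConj_of_lt hLcN hℓ.2 hℓ.1
  · -- nonnegativity of the weights
    intro ℓ
    have hsum : 0 < E.cellVisc (m + 1) + c / E.cellVisc (m + 1) := by positivity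
    have hτ0 : 0 ≤ E.a (m + 1) * (s' - s) := mul_nonneg (E.a_pos _).le (by linarith)
    have hR : 0 ≤ 8 * Real.pi ^ 2 * ‖Torus.latticeVec ℓ‖ ^ 2 * (hi * Λ) * (E.cellVisc (m + 1) + c / E.cellVisc (m + 1))
        / (E.N (m + 1) : ℝ) ^ 2 := by
      have : 0 ≤ hi := hlo.le.trans hhi
      positivity
    have hX : 0 ≤ E.cellVisc (m + 1) ^ σ + (‖Torus.latticeVec ℓ‖ * (⌈K / E.cellVisc (m + 1)⌉₊ : ℝ) / E.N (m + 1)) ^ σ := by positivity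
    have hmin : 0 ≤ min 1 (8 * Real.pi ^ 2 * ‖Torus.latticeVec ℓ‖ ^ 2 * (hi * Λ) * (E.cellVisc (m + 1) + c / E.cellVisc (m + 1))
        / (E.N (m + 1) : ℝ) ^ 2 * (E.a (m + 1) * (s' - s))) := le_min zero_le_one (mul_nonneg hR hτ0)
    have hP : 0 ≤ M * W.period / E.cellVisc (m + 1) := by
      have := PermissibleCarrier.period_pos W
      positivity
    have herr : 0 ≤ (C * (C * (E.cellVisc (m + 1) ^ σ + (‖Torus.latticeVec ℓ‖ * (⌈K / E.cellVisc (m + 1)⌉₊ : ℝ) / E.N (m + 1)) ^ σ)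
              * min 1 ((8 * Real.pi ^ 2 * ‖Torus.latticeVec ℓ‖ ^ 2 * (hi * Λ) * (E.cellVisc (m + 1) + c / E.cellVisc (m + 1)) / (E.N (m + 1) : ℝ) ^ 2) * (E.a (m + 1) * (s' - s)))
            + (8 * Real.pi ^ 2 * ‖Torus.latticeVec ℓ‖ ^ 2 * (hi * Λ) * (E.cellVisc (m + 1) + c / E.cellVisc (m + 1)) / (E.N (m + 1) : ℝ) ^ 2)
              * (M * W.period / E.cellVisc (m + 1)))) :=
      mul_nonneg hC (add_nonneg (mul_nonneg (mul_nonneg hC hX) hmin) (mul_nonneg hR hP))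
    positivity
  · intro z; exact hUm1.apply_eq_apply_starProjection s s' z
  · intro z; exact hUm.apply_eq_apply_starProjection s s' z
  · intro c' z hz k' hk'
    exact fcoeff_apply_eq_zero_of_classes hUm1 h𝔸1 hlo1 hb1 hbdiv1 hN hgrid1 c' hs0 h1.le h3 z hz k' hk'
  · intro c' z hz k' hk'
    exact fcoeff_apply_eq_zero_of_classes hUm h𝔸0 hlo0 hb0 hbdiv0 hN hgrid0 c' hs0 h1.le h3 z hz k' hk'
  · -- the modewise bound on pair data
    intro ℓ hℓ v hvdiv hvsupp
    rw [Finset.mem_erase] at hℓ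
    obtain ⟨i₀, hi₀, hsmall⟩ := exists_coord_of_ne_zero hLcN hℓ.2 hℓ.1
    -- the grid point `e_{i₀}/N` and its sine
    set jj : Fin 3 → Fin N := fun i => if i = i₀ then ⟨1 % N, Nat.mod_lt _ hN⟩ else ⟨0, hN⟩ with hjj
    have hN1 : 1 < N := by have : (1:ℤ) ≤ |ℓ i₀| := Int.one_le_abs hi₀; omega
    have hjj0 : (jj i₀ : ℕ) = 1 := by simp [hjj, Nat.mod_eq_of_lt hN1]
    have hjj' : ∀ i, i ≠ i₀ → (jj i : ℕ) = 0 := fun i hi => by simp [hjj, hi]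
    have him := im_mFourier_grid_ne_zero hN hi₀ hsmall jj hjj0 hjj'
    have hU := fun z : V2 => map_translate_eq hUm1 h𝔸1 hlo1 hb1 hbdiv1
      (fun i => ((((jj i : ℕ) : ℝ) / N : ℝ) : UnitAddCircle)) (hgrid1 jj) hs0 h1.le h3 z
    have hT := fun z : V2 => map_translate_eq hUm h𝔸0 hlo0 hb0 hbdiv0
      (fun i => ((((jj i : ℕ) : ℝ) / N : ℝ) : UnitAddCircle)) (hgrid0 jj) hs0 h1.le h3 z
    -- scale separation for this `ℓ`
    have hscaleℓ : ‖Torus.latticeVec ℓ‖ * (⌈K / E.cellVisc (m + 1)⌉₊ : ℝ) ≤ E.N (m + 1) := by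
      have hℓn : ‖Torus.latticeVec ℓ‖ ≤ ((Lc / 2 : ℕ) : ℝ) := by
        have h2 := hℓ.2
        rw [Torus.mem_freqBall] at h2
        have hsq : ‖Torus.latticeVec ℓ‖ ^ 2 ≤ (((Lc / 2 : ℕ) : ℝ)) ^ 2 := by rw [norm_latticeVec_sq']; exact h2
        exact (pow_le_pow_iff_left₀ (norm_nonneg _) (Nat.cast_nonneg _) (by norm_num : (2:ℕ) ≠ 0)).1 hsq
      exact (mul_le_mul_of_nonneg_right hℓn (Nat.cast_nonneg _)).trans hscale
    have hcos := norm_fcoeff_window_sub_cos_le E hL hdes hgain m hV hΛ hlo hhi hc hC hν₀ hSo hSn hΦSn hUm hUm1 j h1 h3 hℓ.1 hscaleℓ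
    have herr0 : 0 ≤ (C * (C * (E.cellVisc (m + 1) ^ σ + (‖Torus.latticeVec ℓ‖ * (⌈K / E.cellVisc (m + 1)⌉₊ : ℝ) / E.N (m + 1)) ^ σ)
              * min 1 ((8 * Real.pi ^ 2 * ‖Torus.latticeVec ℓ‖ ^ 2 * (hi * Λ) * (E.cellVisc (m + 1) + c / E.cellVisc (m + 1)) / (E.N (m + 1) : ℝ) ^ 2) * (E.a (m + 1) * (s' - (j : ℝ) * E.refresh (m + 1))))
            + (8 * Real.pi ^ 2 * ‖Torus.latticeVec ℓ‖ ^ 2 * (hi * Λ) * (E.cellVisc (m + 1) + c / E.cellVisc (m + 1)) / (E.N (m + 1) : ℝ) ^ 2)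
              * (M * W.period / E.cellVisc (m + 1)))) := by
      have hsum : 0 < E.cellVisc (m + 1) + c / E.cellVisc (m + 1) := by positivity
      have hτ0 : 0 ≤ E.a (m + 1) * (s' - (j : ℝ) * E.refresh (m + 1)) := mul_nonneg (E.a_pos _).le (by linarith)
      have hR : 0 ≤ 8 * Real.pi ^ 2 * ‖Torus.latticeVec ℓ‖ ^ 2 * (hi * Λ) * (E.cellVisc (m + 1) + c / E.cellVisc (m + 1))
          / (E.N (m + 1) : ℝ) ^ 2 := by
        have : 0 ≤ hi := hlo.le.trans hhi
        positivity
      have hX : 0 ≤ E.cellVisc (m + 1) ^ σ + (‖Torus.latticeVec ℓ‖ * (⌈K / E.cellVisc (m + 1)⌉₊ : ℝ) / E.N (m + 1)) ^ σ := by positivity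
      have hmin : 0 ≤ min 1 (8 * Real.pi ^ 2 * ‖Torus.latticeVec ℓ‖ ^ 2 * (hi * Λ) * (E.cellVisc (m + 1) + c / E.cellVisc (m + 1))
          / (E.N (m + 1) : ℝ) ^ 2 * (E.a (m + 1) * (s' - (j : ℝ) * E.refresh (m + 1)))) := le_min zero_le_one (mul_nonneg hR hτ0)
      have hP : 0 ≤ M * W.period / E.cellVisc (m + 1) := by
        have := PermissibleCarrier.period_pos W
        positivity
      exact mul_nonneg hC (add_nonneg (mul_nonneg (mul_nonneg hC hX) hmin) (mul_nonneg hR hP))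
    exact norm_fcoeff_sub_pair_le_of_cos (Um1 s s') (Um s s') _ hU hT hℓ.1 him herr0 hcos v hvdiv hvsupp

end Summit.AnomalousDissipation.AnomalousDissipation.Theorems.SolenoidalFractalHomogenisation.LagrangianStep.FlatWindow

end
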